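import Mathlib
import HarnessLib
import Summits.Langlands.Langlands.Theses.SkinnerWilesDefectOne
import Summits.Langlands.Langlands.Theorems.ReducibleOrdinaryProModular.Negative.LevelAndRamification
import Literature.NumberTheory.GaloisRepresentations.NearlyOrdinaryDeformationRing
import Summits.Langlands.Langlands.Theorems.SkinnerWilesDefectOneReducibleOrdinaryProModularDefs

/-! # Closed-point infrastructure for the regime stub `stub_complementRegime` (S6') of line steinberg-hyperplane
(crux ReducibleOrdinaryProModular, stmt-Langlands-12919)

Helper file (registered sub-goal `stub_complementRegime_auxClosedPoint`); it does NOT prove the regime stub.  It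
certifies in-tree that the regime predicate `UniqueAdmissibleExtension ρ ρ₀ = ∀ M, M.Models ρ ρ₀ (baseLevel ρ) →
ClosedPointStratumLE M.𝓡 2` is not vacuous for a typing reason:

* `not_uniqueAdmissibleExtension_iff` — what the regime's complement literally says: some oriented model `M` at
  the base level has a reducible prime `𝔮` of characteristic `p` with finite-order ratio and `¬ dim R/𝔮 ≤ 2`.
* `exists_frame_iff_mem_reducibleLocus` — the frames over
  which `HasFiniteOrderRatio` quantifies are EXACTLY the witnesses of `𝔮 ∈ reducibleLocus` (same representation
  `fracModPrime = GL₂(algebraMap) ∘ modPrime`, `MulAut.conj P⁻¹ x = P⁻¹ x P`): non-vacuous on the reducible locus,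
  vacuous (hence harmless, the locus hypothesis comes first) off it.
* `antecedents_at_closedPoint` (= the registered wrapper `stub_complementRegime_auxClosedPoint`) — in EVERY model
  whose residual representation is upper triangular (which `Models.residual_upper` imposes) the closed point `𝔪_R`
  satisfies all three antecedents of `ClosedPointStratumLE` simultaneously (`𝔪 ∈ reducibleLocus`,
  `CharP (R/𝔪) p`, `HasFiniteOrderRatio`), with `ringKrullDim (R/𝔪) = 0`.  So none of "`HasFiniteOrderRatio`
  unsatisfiable", "`CharP` never holds" is a typing obstruction; a witness of `¬ UniqueAdmissibleExtension` is
  necessarily a NON-closed reducible characteristic-`p` prime of dimension `≥ 3` on the constant-`Ψ` stratum —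
  i.e. `m_{S♯} ≥ 2` (SkinnerWiles1999 Lemma 2.7 count `m_S + 1`), mathematics, not typing.

All statements are elementary commutative algebra over the tree's `NearlyOrdinaryDeformationRing` interface
(`ker_π`, `isLift.residual_eq`, `mem_reducibleLocus_of_isReducible_modPrime`). [folklore]
-/

set_option linter.dupNamespace false
set_option autoImplicit false

namespace Summit.Langlands.Langlands.Cruxes.ReducibleOrdinaryProModular.SteinbergHyperplane

open scoped NumberField MatrixGroups
open Filter NumberField IsDedekindDomain Field Polynomial Matrix
open Literature.NumberTheory.Automorphic Literature.NumberTheory.Automorphic.BigHeckeGLn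
open Literature.NumberTheory.GaloisRepresentations
open Summit.Langlands.Langlands.Theses.SkinnerWilesDefectOne

noncomputable section

section ClosedPoint

variable {F : Type} [Field F] [NumberField F] {p : ℕ} [Fact p.Prime]

/-- **A1.** The complement of the regime, unfolded: an oriented base-level model with a reducible
characteristic-`p` prime of finite-order ratio and `dim R/𝔮 > 2`. [folklore] -/
theorem not_uniqueAdmissibleExtension_iff {O : ValuationSubring (PadicAlgCl p)}
    (ρ : FramedGaloisRep F (PadicAlgCl p) 2) (ρ₀ : absoluteGaloisGroup F →* GL (Fin 2) O) :
    ¬ UniqueAdmissibleExtension ρ ρ₀ ↔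
      ∃ M : ModelData F p, M.Models ρ ρ₀ (baseLevel ρ) ∧
        ∃ 𝔮 ∈ M.𝓡.reducibleLocus, CharP (M.𝓡.R ⧸ 𝔮.asIdeal) p ∧ HasFiniteOrderRatio M.𝓡 𝔮 ∧
          ¬ ringKrullDim (M.𝓡.R ⧸ 𝔮.asIdeal) ≤ 2 := by
  simp only [UniqueAdmissibleExtension, ClosedPointStratumLE, not_forall, exists_prop]

variable {𝒪 : Type} [CommRing 𝒪] {k : Type} [Field k] [Algebra 𝒪 k] {𝒟 : NearlyOrdinaryDatum F p 𝒪 k}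
  (𝓡 : NearlyOrdinaryDeformationRing.{0} 𝒟)

omit [Fact p.Prime] in
/-- **A2.** The frames over which `HasFiniteOrderRatio 𝓡 𝔮` quantifies exist iff `𝔮 ∈ reducibleLocus`; in
particular off the reducible locus `HasFiniteOrderRatio 𝓡 𝔮` holds vacuously (no frame; this corollary is the
tree's `Literature.NumberTheory.GaloisRepresentations.hasFiniteOrderRatio_of_not_mem_reducibleLocus` for the
parallel `Literature` copy of the vocabulary, `AdmissibleExtensionRegime.lean`). [folklore] -/
theorem exists_frame_iff_mem_reducibleLocus (𝔮 : PrimeSpectrum 𝓡.R) :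
    (∃ P : GL (Fin 2) (FractionRing (𝓡.R ⧸ 𝔮.asIdeal)),
        ∀ γ, (((MulAut.conj P⁻¹).toMonoidHom.comp (fracModPrime 𝓡 𝔮)) γ).val 1 0 = 0) ↔
      𝔮 ∈ 𝓡.reducibleLocus := by
  simp only [NearlyOrdinaryDeformationRing.reducibleLocus, Deformation.IsReducible, Set.mem_setOf_eq,
    fracModPrime, MonoidHom.comp_apply, MulEquiv.coe_toMonoidHom, MulAut.conj_apply, inv_inv]

omit [Fact p.Prime] in
/-- **A3a.** If `ρ̄` is upper triangular, the closed point is a reducible prime (frame `P = 1` already over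
`R/𝔪`). [folklore] -/
theorem closedPoint_mem_reducibleLocus (hres : ∀ g, (𝒟.residual g).val 1 0 = 0) :
    IsLocalRing.closedPoint 𝓡.R ∈ 𝓡.reducibleLocus := by
  refine 𝓡.mem_reducibleLocus_of_isReducible_modPrime _ ⟨1, fun γ => ?_⟩
  rw [inv_one, one_mul, mul_one]
  change Ideal.Quotient.mk _ ((𝓡.ρ γ).val 1 0) = 0
  rw [Ideal.Quotient.eq_zero_iff_mem]
  change (𝓡.ρ γ).val 1 0 ∈ IsLocalRing.maximalIdeal 𝓡.R
  rw [← 𝓡.ker_π, RingHom.mem_ker]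
  have h := congrArg (fun f : absoluteGaloisGroup F →* GL (Fin 2) k => (f γ).val 1 0)
    𝓡.isLift.residual_eq
  simpa [hres γ] using h

/-- **A3b.** The closed point has residue characteristic `p` (`R/𝔪 = k`, `CharP k p`). [folklore] -/
theorem charP_quotient_closedPoint [CharP k p] :
    CharP (𝓡.R ⧸ (IsLocalRing.closedPoint 𝓡.R).asIdeal) p := by
  haveI := (IsLocalRing.closedPoint 𝓡.R).isPrime
  refine (CharP.charP_iff_prime_eq_zero Fact.out).mpr ?_
  rw [← map_natCast (Ideal.Quotient.mk (IsLocalRing.closedPoint 𝓡.R).asIdeal) p,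
    Ideal.Quotient.eq_zero_iff_mem]
  change (p : 𝓡.R) ∈ IsLocalRing.maximalIdeal 𝓡.R
  rw [← 𝓡.ker_π, RingHom.mem_ker, map_natCast, CharP.cast_eq_zero]

omit [Fact p.Prime] in
/-- **A3c.** `R/𝔪` is finite when `k` is. [folklore] -/
theorem finite_quotient_closedPoint [Finite k] : Finite (𝓡.R ⧸ (IsLocalRing.closedPoint 𝓡.R).asIdeal) := by
  change Finite (𝓡.R ⧸ IsLocalRing.maximalIdeal 𝓡.R)
  have H : ∀ a ∈ IsLocalRing.maximalIdeal 𝓡.R, (𝓡.π : 𝓡.R →+* k) a = 0 := fun a ha => by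
    rwa [← 𝓡.ker_π, RingHom.mem_ker] at ha
  exact Finite.of_injective _ (RingHom.lift_injective_of_ker_le_ideal _ H 𝓡.ker_π.le)

omit [Fact p.Prime] in
/-- **A3d.** At the closed point the ratio of diagonal characters has finite order in EVERY frame (values in
the finite group `Frac(R/𝔪)ˣ = kˣ`). [folklore] -/
theorem hasFiniteOrderRatio_closedPoint [Finite k] :
    HasFiniteOrderRatio 𝓡 (IsLocalRing.closedPoint 𝓡.R) := by
  intro P hP
  haveI := finite_quotient_closedPoint 𝓡
  haveI : Finite (FractionRing (𝓡.R ⧸ (IsLocalRing.closedPoint 𝓡.R).asIdeal)) :=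
    Finite.of_surjective _
      (IsLocalization.mk'_surjective (S := FractionRing (𝓡.R ⧸ (IsLocalRing.closedPoint 𝓡.R).asIdeal))
        (nonZeroDivisors (𝓡.R ⧸ (IsLocalRing.closedPoint 𝓡.R).asIdeal)))
  refine isOfFinOrder_iff_pow_eq_one.mpr
    ⟨Nat.card (FractionRing (𝓡.R ⧸ (IsLocalRing.closedPoint 𝓡.R).asIdeal))ˣ, Nat.card_pos, ?_⟩
  ext γ
  simp [MonoidHom.pow_apply, pow_card_eq_one']

omit [Fact p.Prime] in
/-- **A3e.** The closed point has dimension `0`. [folklore] -/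
theorem ringKrullDim_quotient_closedPoint :
    ringKrullDim (𝓡.R ⧸ (IsLocalRing.closedPoint 𝓡.R).asIdeal) = 0 :=
  ringKrullDim_eq_zero_of_isField <|
    (Ideal.Quotient.maximal_ideal_iff_isField_quotient _).mp (IsLocalRing.maximalIdeal.isMaximal 𝓡.R)

/-- **A3 (summary).** In every oriented model the three antecedents of `ClosedPointStratumLE` hold TOGETHER at the
closed point (so the regime predicate is not vacuous), where the bound holds with dimension `0`; a failure of
`UniqueAdmissibleExtension` therefore lives at a non-closed reducible characteristic-`p` prime of dimension `≥ 3`.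
[folklore] -/
theorem antecedents_at_closedPoint (M : ModelData F p) {O : ValuationSubring (PadicAlgCl p)}
    {ρ : FramedGaloisRep F (PadicAlgCl p) 2} {ρ₀ : absoluteGaloisGroup F →* GL (Fin 2) O}
    {S : Set (HeightOneSpectrum (𝓞 F))} (hM : M.Models ρ ρ₀ S) :
    IsLocalRing.closedPoint M.𝓡.R ∈ M.𝓡.reducibleLocus ∧
      CharP (M.𝓡.R ⧸ (IsLocalRing.closedPoint M.𝓡.R).asIdeal) p ∧
      HasFiniteOrderRatio M.𝓡 (IsLocalRing.closedPoint M.𝓡.R) ∧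
      ringKrullDim (M.𝓡.R ⧸ (IsLocalRing.closedPoint M.𝓡.R).asIdeal) ≤ 2 :=
  ⟨closedPoint_mem_reducibleLocus M.𝓡 hM.residual_upper, charP_quotient_closedPoint M.𝓡,
    hasFiniteOrderRatio_closedPoint M.𝓡, by rw [ringKrullDim_quotient_closedPoint]; exact zero_le_two⟩

end ClosedPoint

/-- **Registered sub-goal of `stub_complementRegime` (closed-point infrastructure): in every oriented model
`M` of `(ρ, ρ₀)` at any level `S` the closed point `𝔪_R` of `R = M.𝓡.R` is a reducible prime of residue
characteristic `p` with finite-order diagonal ratio in every frame and `dim R/𝔪 ≤ 2` — all antecedents of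
`ClosedPointStratumLE M.𝓡 2` hold together at `𝔪`, so the regime predicate is not vacuous
(= `antecedents_at_closedPoint` with explicit binders). [folklore] -/
theorem stub_complementRegime_auxClosedPoint :
    ∀ (F : Type) [Field F] [NumberField F] (p : ℕ) [Fact p.Prime] (M : ModelData F p) (O : ValuationSubring (PadicAlgCl p)) (ρ : FramedGaloisRep F (PadicAlgCl p) 2) (ρ₀ : absoluteGaloisGroup F →* GL (Fin 2) O) (S : Set (HeightOneSpectrum (𝓞 F))), M.Models ρ ρ₀ S → IsLocalRing.closedPoint M.𝓡.R ∈ M.𝓡.reducibleLocus ∧ CharP (M.𝓡.R ⧸ (IsLocalRing.closedPoint M.𝓡.R).asIdeal) p ∧ HasFiniteOrderRatio M.𝓡 (IsLocalRing.closedPoint M.𝓡.R) ∧ ringKrullDim (M.𝓡.R ⧸ (IsLocalRing.closedPoint M.𝓡.R).asIdeal) ≤ 2 :=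
  fun _ _ _ _ _ M _ _ _ _ hM => antecedents_at_closedPoint M hM

end

end Summit.Langlands.Langlands.Cruxes.ReducibleOrdinaryProModular.SteinbergHyperplane
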